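import Mathlib
import Summits.Ventures.PercRepro2.OneTypedEdge
import Summits.Ventures.PercRepro2.TypedUntouched
import Summits.Ventures.PercRepro2.TypedSwapRoots
import Summits.Ventures.PercRepro2.TypedCoincRootEdge
import Summits.Ventures.PercRepro2.TypedPositiveOB

/-!
# Positivity rules, continued: the stars at `o` and at `b` (blind cell PercRepro2, night-3 g14,
2026-08-27; `proofs/NIGHT3-CERT.md` §23.6)

With the state inequalities and the colouring case analysis of `TypedPositiveOB.lean`: `o` adjacent
to both roots and to `b`, the `a₁`-edge of type 1 and the other two of type 2, forces every typed
triple into a root connection or into two copies with `o, b` together in a root cluster, so every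
typed base is nonnegative (`typedCount_nonneg_of_o_star`); the same with `b` in the place of `o`
(`typedCount_nonneg_of_b_star`); mirrors at `a₂`.  Nothing here asserts anything about the original
lane.
-/

namespace Summit.Ventures.PercRepro2

open UnionCluster

namespace CovForm

namespace PositiveOB

open OneTyped Untouched CoincRoot

section Main

open Classical

variable {V : Type*} {E : Type*} [Fintype E] [DecidableEq E] {R : Type*} [Field R]
  [LinearOrder R] [IsStrictOrderedRing R]
variable (ends : E → Sym2 V) (o a₁ a₂ a₃ b : V)

omit [Fintype E] [DecidableEq E] [LinearOrder R] [IsStrictOrderedRing R] in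
/-- At the star `e = {a₁, o}`, `f = {a₂, o}`, `g = {o, b}`, a copy carrying `e, g` has `o, b ∈ C(a₁)`
and a copy carrying `f, g` has `o, b ∈ C(a₂)`. -/
lemma together_of_star {e f g : E} (he : ends e = s(a₁, o)) (hf : ends f = s(a₂, o))
    (hg : ends g = s(o, b)) (u : Config E)
    (h : (u e = true ∧ u g = true) ∨ (u f = true ∧ u g = true)) : ((Conn ends u a₁ o ∧ Conn ends u a₁ b) ∨ (Conn ends u a₂ o ∧ Conn ends u a₂ b)) := by
  have ce : u e = true → Conn ends u a₁ o := fun hu => conn_of_openAdj ⟨e, hu, he⟩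
  have cf : u f = true → Conn ends u a₂ o := fun hu => conn_of_openAdj ⟨f, hu, hf⟩
  have cg : u g = true → Conn ends u o b := fun hu => conn_of_openAdj ⟨g, hu, hg⟩
  rcases h with ⟨h1, h2⟩ | ⟨h1, h2⟩
  · exact Or.inl ⟨ce h1, conn_trans (ce h1) (cg h2)⟩
  · exact Or.inr ⟨cf h1, conn_trans (cf h1) (cg h2)⟩

/-- **`o` adjacent to both roots and to `b`, the `a₁`-edge of type 1, the others of type 2: every
typed base is nonnegative.** -/
theorem typedCount_nonneg_of_o_star {e f g : E} (he : ends e = s(a₁, o)) (hf : ends f = s(a₂, o))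
    (hg : ends g = s(o, b)) (F : Finset E) (heF : e ∈ F) (hfF : f ∈ F) (hgF : g ∈ F) (z : Config E)
    (τ : E → ℕ) (hτ : ∀ e ∈ F, τ e = 1 ∨ τ e = 2) (hτe : τ e = 1) (hτf : τ f = 2) (hτg : τ g = 2) :
    0 ≤ typedCount F z τ (K3 ends o a₁ a₂ a₃ b : Config E → Config E → Config E → R) := by
  refine typedCount_nonneg_of_KBsym ends o a₁ a₂ a₃ b F z τ hτ fun x y w _ hτ' => ?_
  have h2e := hτ' e heF
  have h2f := hτ' f hfF
  have h2g := hτ' g hgF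
  rw [hτe] at h2e
  rw [hτf] at h2f
  rw [hτg] at h2g
  have key := together_of_star ends o a₁ a₂ b he hf hg
  have both : ∀ u : Config E, u e = true ∧ u f = true → Conn ends u a₂ a₁ :=
    fun u ⟨h1, h2⟩ => conn_trans (conn_of_openAdj ⟨f, h2, hf⟩) (conn_symm (conn_of_openAdj ⟨e, h1, he⟩))
  rcases star_cases h2e h2f h2g with h | ⟨hx, hy⟩ | ⟨hx, hw⟩ | ⟨hy, hw⟩
  · rw [KBsym_st_eq_zero_of_conn ends o a₁ a₂ a₃ b x y w (by
      rcases h with h | h | h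
      · exact Or.inl (both x h)
      · exact Or.inr (Or.inl (both y h))
      · exact Or.inr (Or.inr (both w h)))]
  · exact KBsym_st_nonneg_of_two_any ends o a₁ a₂ a₃ b x y w (Or.inl ⟨key x hx, key y hy⟩)
  · exact KBsym_st_nonneg_of_two_any ends o a₁ a₂ a₃ b x y w (Or.inr (Or.inl ⟨key x hx, key w hw⟩))
  · exact KBsym_st_nonneg_of_two_any ends o a₁ a₂ a₃ b x y w (Or.inr (Or.inr ⟨key y hy, key w hw⟩))

omit [Fintype E] [DecidableEq E] [LinearOrder R] [IsStrictOrderedRing R] in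
/-- At the star `e = {a₁, b}`, `f = {a₂, b}`, `g = {o, b}`, a copy carrying `e, g` has `o, b ∈ C(a₁)`
and a copy carrying `f, g` has `o, b ∈ C(a₂)`. -/
lemma together_of_star_b {e f g : E} (he : ends e = s(a₁, b)) (hf : ends f = s(a₂, b))
    (hg : ends g = s(o, b)) (u : Config E)
    (h : (u e = true ∧ u g = true) ∨ (u f = true ∧ u g = true)) : ((Conn ends u a₁ o ∧ Conn ends u a₁ b) ∨ (Conn ends u a₂ o ∧ Conn ends u a₂ b)) := by
  have ce : u e = true → Conn ends u a₁ b := fun hu => conn_of_openAdj ⟨e, hu, he⟩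
  have cf : u f = true → Conn ends u a₂ b := fun hu => conn_of_openAdj ⟨f, hu, hf⟩
  have cg : u g = true → Conn ends u o b := fun hu => conn_of_openAdj ⟨g, hu, hg⟩
  rcases h with ⟨h1, h2⟩ | ⟨h1, h2⟩
  · exact Or.inl ⟨conn_trans (ce h1) (conn_symm (cg h2)), ce h1⟩
  · exact Or.inr ⟨conn_trans (cf h1) (conn_symm (cg h2)), cf h1⟩

/-- **`b` adjacent to both roots and to `o`, the `a₁`-edge of type 1, the others of type 2: every
typed base is nonnegative.** -/
theorem typedCount_nonneg_of_b_star {e f g : E} (he : ends e = s(a₁, b)) (hf : ends f = s(a₂, b))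
    (hg : ends g = s(o, b)) (F : Finset E) (heF : e ∈ F) (hfF : f ∈ F) (hgF : g ∈ F) (z : Config E)
    (τ : E → ℕ) (hτ : ∀ e ∈ F, τ e = 1 ∨ τ e = 2) (hτe : τ e = 1) (hτf : τ f = 2) (hτg : τ g = 2) :
    0 ≤ typedCount F z τ (K3 ends o a₁ a₂ a₃ b : Config E → Config E → Config E → R) := by
  refine typedCount_nonneg_of_KBsym ends o a₁ a₂ a₃ b F z τ hτ fun x y w _ hτ' => ?_
  have h2e := hτ' e heF
  have h2f := hτ' f hfF
  have h2g := hτ' g hgF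
  rw [hτe] at h2e
  rw [hτf] at h2f
  rw [hτg] at h2g
  have key := together_of_star_b ends o a₁ a₂ b he hf hg
  have both : ∀ u : Config E, u e = true ∧ u f = true → Conn ends u a₂ a₁ :=
    fun u ⟨h1, h2⟩ => conn_trans (conn_of_openAdj ⟨f, h2, hf⟩) (conn_symm (conn_of_openAdj ⟨e, h1, he⟩))
  rcases star_cases h2e h2f h2g with h | ⟨hx, hy⟩ | ⟨hx, hw⟩ | ⟨hy, hw⟩
  · rw [KBsym_st_eq_zero_of_conn ends o a₁ a₂ a₃ b x y w (by
      rcases h with h | h | h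
      · exact Or.inl (both x h)
      · exact Or.inr (Or.inl (both y h))
      · exact Or.inr (Or.inr (both w h)))]
  · exact KBsym_st_nonneg_of_two_any ends o a₁ a₂ a₃ b x y w (Or.inl ⟨key x hx, key y hy⟩)
  · exact KBsym_st_nonneg_of_two_any ends o a₁ a₂ a₃ b x y w (Or.inr (Or.inl ⟨key x hx, key w hw⟩))
  · exact KBsym_st_nonneg_of_two_any ends o a₁ a₂ a₃ b x y w (Or.inr (Or.inr ⟨key y hy, key w hw⟩))

/-- The mirror of the `o`-star: the `a₂`-edge of type 1. -/
theorem typedCount_nonneg_of_o_star' {e f g : E} (he : ends e = s(a₂, o)) (hf : ends f = s(a₁, o))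
    (hg : ends g = s(o, b)) (F : Finset E) (heF : e ∈ F) (hfF : f ∈ F) (hgF : g ∈ F) (z : Config E)
    (τ : E → ℕ) (hτ : ∀ e ∈ F, τ e = 1 ∨ τ e = 2) (hτe : τ e = 1) (hτf : τ f = 2) (hτg : τ g = 2) :
    0 ≤ typedCount F z τ (K3 ends o a₁ a₂ a₃ b : Config E → Config E → Config E → R) := by
  rw [← SwapRoots.typedCount_swap_roots ends o a₁ a₂ a₃ b F z τ]
  exact typedCount_nonneg_of_o_star ends o a₂ a₁ a₃ b he hf hg F heF hfF hgF z τ hτ hτe hτf hτg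

/-- The mirror of the `b`-star: the `a₂`-edge of type 1. -/
theorem typedCount_nonneg_of_b_star' {e f g : E} (he : ends e = s(a₂, b)) (hf : ends f = s(a₁, b))
    (hg : ends g = s(o, b)) (F : Finset E) (heF : e ∈ F) (hfF : f ∈ F) (hgF : g ∈ F) (z : Config E)
    (τ : E → ℕ) (hτ : ∀ e ∈ F, τ e = 1 ∨ τ e = 2) (hτe : τ e = 1) (hτf : τ f = 2) (hτg : τ g = 2) :
    0 ≤ typedCount F z τ (K3 ends o a₁ a₂ a₃ b : Config E → Config E → Config E → R) := by
  rw [← SwapRoots.typedCount_swap_roots ends o a₁ a₂ a₃ b F z τ]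
  exact typedCount_nonneg_of_b_star ends o a₂ a₁ a₃ b he hf hg F heF hfF hgF z τ hτ hτe hτf hτg

end Main

end PositiveOB

end CovForm

end Summit.Ventures.PercRepro2
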